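import Literature.MathematicalPhysics.QuantumFieldTheory.Balaban1983to89.B8Prop3SrcZd3Gamma
import Literature.MathematicalPhysics.QuantumFieldTheory.Balaban1983to89.B8Prop3SrcZd3H
import Literature.MathematicalPhysics.QuantumFieldTheory.Balaban1983to89.B8LeafModelZd3P2

/-!
# `Balaban1983to89.B8Prop3SrcZd3HP2Gamma` — [Balaban1985RegularSpaces] PROPOSITION 3 WITH SOURCE (Prop. 3 p. 87 ∕ Thm 8 (1.146) p. 101) ON THE EDITION-δ₂
# P-CARRIER `B8LeafModelZd3P2.zdGF3HP₂`, from the SOURCED b9 socket of Proposition 3's frame with its Hölder line read «on Ω_j» (both points of the pair in Ω_j)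
# — D7-2b₂, the token-swap twin of this seat's D7-2b `B8Prop3SrcZd3HPGamma` (p589717)

statement-level skeleton of published theorems with citation tags; proofs where landed; nothing here is a claim about the Yang–Mills mass gap

T. Bałaban, *Spaces of regular gauge field configurations on a lattice and gauge fixing conditions*, Commun. Math. Phys. **99** (1985) 75–102
`[Balaban1985RegularSpaces]` ("B8"): Prop. 3 p. 87, (1.40)–(1.42) p. 83, (1.59)–(1.62) pp. 86–87, (1.36)–(1.39) p. 82 («on Ω_j»), Thm 8 (1.146) p. 101.
T. Bałaban, *Propagators for lattice gauge theories in a background field*, Commun. Math. Phys. **99** (1985) 389–434 `[Balaban1985BackgroundPropagators]` ("[4]"):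
Thm 3.3 p. 398 with (3.42)–(3.43), (3.40) p. 397.  PDF held: `paper:balaban1985-cmp99-regular-spaces-gauge-fixing`.

CITATION HEADER (lean-in-tree rule).  Cell `pub-ymgap` (HUMAN RULING D-0062, Track A), DAG node N05 = [B8], seat `pub-ymgap-dag-n05-d` (g11; R134 row s2).
WHY THIS FILE.  LOCATED NARROWNESS №4 (cell bus 2026-08-28): the Hölder member of (1.36) and the Hölder line of (1.59) are printed over pairs with BOTH points in Ω_j
([4] (3.40)); the tree typed them over the first-point class.  This seat's `B8LeafModelZd3P2` (p599986) is the edition-δ₂ carrier (`zdGF3HP₂`: `C136`'s Hölder clause on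
Ω_j × Ω_j pairs).  THIS FILE is D7-2b RE-RUN token for token with the sourced socket's Hölder line over the both-points class and the conclusion on `zdGF3HP₂`: the
engines (`B8Prop3SrcZd3Gamma.prop3_norms_kLevel_src4_γ` ∕ `prop3_fifth_kLevel_src_γ`) are class-agnostic, so the socket's line 5 lands verbatim in the carrier's
clause.  Generator `gen_p2twins.py` on the tree bytes of D7-2b.

WHAT THIS FILE PROVES (one theorem, no `def`).
★★ `sp3src_zdGF3HP₂_map_of_sockB9P3srcHP₂_γ` — for any index map `ι : J → ZdIdx d L`: from the sourced Prop.-3-frame socket at each `ι a` (five (1.59) lines with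
source terms, Hölder line on Ω_j × Ω_j pairs, |B₁| over print's class `towerBondsP`), `∃ c > 0` such that print's Prop.-3 sentence WITH SOURCE holds at
`zdGF3HP₂ 𝔸 L β len (ι a)`: (1.40)–(1.42) + (1.146) + (1.61) ⇒ (1.36) ∧ (1.39) at `B₁ = 5dL·B₈`, `B₂ = 5dL·B₈β`.

HONEST SCOPE.  Assembly BY NAME; the sourced socket is a HYPOTHESIS (N06 content; [4] Thm 3.3 with source); `≤` where print has `<`; `T_η ↦ ℤᵈ`.  Count-neutral;
N05 NOT discharged; one finite `T⁴` programme at fixed `ε`, Bałaban as printed — nothing continuum ∕ ℝ⁴ ∕ OS ∕ mass-gap ∕ Clay.  No `sorry`, no `def`, no `instance`,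
no `notation`.  Unit `pub-ymgap-dag-n05-d` (g11), 2026-08-28.
-/

noncomputable section

open NormedSpace

namespace Literature.MathematicalPhysics.QuantumFieldTheory.Balaban1983to89.B8Prop3SrcZd3HP2Gamma

open Complex (I)
open MatrixLog B7Prop1Explicit B7Prop2Explicit B7Prop1Local B7Eq92Concrete
open B7Prop2Explicit (C0 c2' unitaryUnits unitaryUnits_le_U1 avgClosed_unitaryUnits)
open B7Prop3Flat (c3)
open B7Prop4GeneralLevels (logCovIter linCovIter)
open B8Lemma1NonAbelian (mulCfg)
open B8Ineq132 (covDerivFwd InAk BondTouches)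
open B8Eq146AExpansion (iEta expCfg plaqCovDeriv)
open B8Eq143PlaqExpansion (pdiv)
open B8Eq155JBound (Jcur wsup)
open B8Eq140Level (SideTouches)
open B8Eq184Proof (cfgExp)
open B8ScaledSupNorm (bondNorm msup weight Bdd)
open B8Eq155KLevelLocal (eq155_norm_kLevel_hermitian)
open B8Prop3KLevelGamma (wsup_B1_le_kLevel_γ prop3_windows_γ)
open B8Prop3KLevel (bound_of_sideTouches)
open B8Eq138LandauZd (IsLandau146W InR138 logCfg covLap)
open B8Prop3GaugeFixedKLevel (inAk_congr_of_sideTouches expCfg_iEta_eq_cfgExp cfgExp_congr_at)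
open B8LeafModelZd (ZdIdx)
open B8LeafModelZd3 (zdGF3 mlogCfg mlogCfg_of_sideTouches mlogCfg_of_not)
open B8LeafModelZd3H (zdGF3H)
open B8LeafModelZd3P (zdGF3P zdGF3HP)
open B8LeafModelZd3P2 (zdGF3P₂ zdGF3HP₂)
open B8TowerBondsPrinted (towerBondsP towerBondsP_box_subset_pred)
open B8Prop3SrcZd3 (apriori_160_src4 apriori_160_fifth_src)
open B8Prop3SrcZd3Gamma (prop3_norms_kLevel_src4_γ prop3_fifth_kLevel_src_γ)
open B9Eq340HolderZd (hquot AdmPair)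

-- `Site` alone could resolve to the torus sites of `Setup.lean`; re-export the `ℤ^d` sites of `B7Prop1Explicit`.
export B7Prop1Explicit (Site)

variable {d : ℕ}

section Zd3HP

variable {𝔸 : Type} [CStarAlgebra 𝔸] [Nontrivial 𝔸]

/-- ★★ **PROPOSITION 3 WITH SOURCE AT THE P-CARRIER `zdGF3HP`, EDITION γ, from the sourced b9 socket at PRINT's class** ((1.42) hypothesis AND the socket's |B₁| over `towerBondsP L (ι a).Ω ((ι a).Λs (ι a).k) ·` — dag-n06-b's `sockB9P3srcHP_univ_explicit_on_lin` shape at that class; windows by `prop3_windows_γ`, threshold `min cP (c_γ∕L²)`, (1.61)-constant `2097152(d+1)²L²`; engine `B8Prop3SrcZd3Gamma` — D7-2b of the `Ω₀ = ℤᵈ` road's γ chain) (`sp3src_zd3_map_of_sockB9P3src` re-run): for any index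
map `ι : J → ZdIdx d L`, if at each `ι a` [4] Thm 3.3 with source holds in Prop. 3's frame (`SB9srcH`: the five (1.59)-lines with source terms `+ γ″B₀(α₀+α₁)`,
Hölder `+ γβ(α₀+α₁)`, for every source `f ∈ R(U₀)` that is HERMITIAN, vanishes off `Ω₀`, has `Bdd` and `|f|₍₋₂₎, |D f|₍₋₃₎ < γ(α₀+α₁)`), then `∃ c > 0` (member-free)
such that print's Prop.-3 sentence WITH SOURCE holds at `zdGF3HP₂ 𝔸 L β len (ι a)`: (1.40)–(1.42) + (1.146) + (1.61) ⇒ (1.36) ∧ (1.39) at `B₁ = 5dL·B₈`,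
`B₂ = 5dL·B₈β`. [cite: Balaban1985RegularSpaces, Prop. 3 p.87, (1.40)–(1.42) p.83, (1.59)–(1.62) pp.86–87, (1.36)–(1.39) p.82, Thm 8 (1.146) p.101] -/
theorem sp3src_zdGF3HP₂_map_of_sockB9P3srcHP₂_γ (hd2 : 2 ≤ d) {L : ℕ} (hL : 2 ≤ L) {B₀ B₀β cP γ γ'' γβ B₈ B₈β : ℝ} (hB₀ : 0 < B₀) (hB₀β : 0 ≤ B₀β)
    (hcP : 0 < cP) (hγ'' : 0 ≤ γ'') (hB8 : 5 * (d : ℝ) * L * B₀ + 2 * (γ'' * B₀) ≤ 5 * (d : ℝ) * L * B₈)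
    (hB8β : 5 * (d : ℝ) * L * B₀β + 2 * B₀β * (γ'' * B₀) + γβ ≤ 5 * (d : ℝ) * L * B₈β) (β : ℝ) (len : Site d → ℝ)
    {J : Type} (ι : J → ZdIdx d L)
    (SB9srcH : ∀ a : J, ∀ α₀ α₁ α₂ : ℝ, 0 < α₀ → α₀ ≤ cP → 0 < α₁ → 0 < α₂ → α₂ ≤ cP →
      ∀ (U₀ W : Site d → Fin d → 𝔸ˣ), (∀ x κ, U₀ x κ ∈ unitaryUnits 𝔸) → (∀ x κ, W x κ ∈ unitaryUnits 𝔸) →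
      ∀ f : Site d → 𝔸, InR138 L (ι a).k (ι a).η ((ι a).Ω 0) ((ι a).Λs (ι a).k) U₀ f →
      (∀ x, IsSelfAdjoint (f x)) → (∀ x, x ∉ (ι a).Ω 0 → f x = 0) →
      Bdd L (ι a).k (ι a).η (-(2 : ℝ)) (fun j (x : Site d) => x ∈ (ι a).Ω j) f →
      msup L (ι a).k (ι a).η (-(2 : ℝ)) (fun j (x : Site d) => x ∈ (ι a).Ω j) f < γ * (α₀ + α₁) →
      msup L (ι a).k (ι a).η (-(3 : ℝ)) (fun j (p : Fin d × Site d) => p.2 ∈ (ι a).Ω j) (fun p => covDerivFwd (ι a).η U₀ p.1 f p.2) < γ * (α₀ + α₁) →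
      InAk L (ι a).k (ι a).η α₀ (ι a).Ω U₀ → InAk L (ι a).k (ι a).η α₀ (ι a).Ω (mulCfg W U₀) → IsLandau146W L (ι a).k (ι a).η ((ι a).Ω 0) ((ι a).Λs (ι a).k) U₀ f W →
      ∀ A' : Site d → Fin d → 𝔸, (∀ y τ, IsSelfAdjoint (A' y τ)) →
      (∀ j, j ≤ (ι a).k → ∀ (y : Site d) (τ : Fin d), SideTouches ((ι a).Ω j) y τ →
        W y τ = cfgExp (ι a).η A' y τ ∧ ‖A' y τ‖ ≤ α₂ * ((L : ℝ) ^ j * (ι a).η)⁻¹) →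
      (∀ (y : Site d) (τ : Fin d), (∀ j, j ≤ (ι a).k → ¬ SideTouches ((ι a).Ω j) y τ) → A' y τ = 0) →
      msup L (ι a).k (ι a).η (-(1 : ℝ)) (fun j (b : Site d × Fin d) => SideTouches ((ι a).Ω j) b.1 b.2) (fun b => A' b.1 b.2)
          ≤ B₀ * (bondNorm L (ι a).k (ι a).η (-(3 : ℝ)) (ι a).Ω (fun x μ => Jcur (ι a).η U₀ A' μ x)
            + wsup 1 (fun p : {p : ℕ × (Site d × Fin d) // p.1 ≤ (ι a).k ∧ p.2 ∈ towerBondsP L (ι a).Ω ((ι a).Λs (ι a).k) p.1} =>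
                linCovIter L U₀ (iEta (ι a).η A') p.1.1 p.1.2.1 p.1.2.2)) + γ'' * B₀ * (α₀ + α₁) ∧
        msup L (ι a).k (ι a).η (-(2 : ℝ)) (fun j (t : Fin d × Fin d × Site d) => SideTouches ((ι a).Ω j) t.2.2 t.2.1)
            (fun t => covDerivFwd (ι a).η U₀ t.1 (fun z => A' z t.2.1) t.2.2)
          ≤ B₀ * (bondNorm L (ι a).k (ι a).η (-(3 : ℝ)) (ι a).Ω (fun x μ => Jcur (ι a).η U₀ A' μ x)
            + wsup 1 (fun p : {p : ℕ × (Site d × Fin d) // p.1 ≤ (ι a).k ∧ p.2 ∈ towerBondsP L (ι a).Ω ((ι a).Λs (ι a).k) p.1} =>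
                linCovIter L U₀ (iEta (ι a).η A') p.1.1 p.1.2.1 p.1.2.2)) + γ'' * B₀ * (α₀ + α₁) ∧
        bondNorm L (ι a).k (ι a).η (-(3 : ℝ)) (ι a).Ω (fun x μ => pdiv (ι a).η U₀ (plaqCovDeriv (ι a).η U₀ A') μ x)
          ≤ B₀ * (bondNorm L (ι a).k (ι a).η (-(3 : ℝ)) (ι a).Ω (fun x μ => Jcur (ι a).η U₀ A' μ x)
            + wsup 1 (fun p : {p : ℕ × (Site d × Fin d) // p.1 ≤ (ι a).k ∧ p.2 ∈ towerBondsP L (ι a).Ω ((ι a).Λs (ι a).k) p.1} =>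
                linCovIter L U₀ (iEta (ι a).η A') p.1.1 p.1.2.1 p.1.2.2)) + γ'' * B₀ * (α₀ + α₁) ∧
        bondNorm L (ι a).k (ι a).η (-(3 : ℝ)) (ι a).Ω (fun x μ => covLap (ι a).η U₀ (fun z => A' z μ) x)
          ≤ B₀ * (bondNorm L (ι a).k (ι a).η (-(3 : ℝ)) (ι a).Ω (fun x μ => Jcur (ι a).η U₀ A' μ x)
            + wsup 1 (fun p : {p : ℕ × (Site d × Fin d) // p.1 ≤ (ι a).k ∧ p.2 ∈ towerBondsP L (ι a).Ω ((ι a).Λs (ι a).k) p.1} =>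
                linCovIter L U₀ (iEta (ι a).η A') p.1.1 p.1.2.1 p.1.2.2)) + γ'' * B₀ * (α₀ + α₁) ∧
        msup L (ι a).k (ι a).η (-(2 + β)) (fun j (q : Fin d × Fin d × (Site d × Site d)) => q.2.2 ∈ AdmPair (ι a).η len ∧ q.2.2.1 ∈ (ι a).Ω j ∧ q.2.2.2 ∈ (ι a).Ω j)
            (fun q => hquot (ι a).η β len U₀ (covDerivFwd (ι a).η U₀ q.1 (fun z => A' z q.2.1)) q.2.2)
          ≤ B₀β * (bondNorm L (ι a).k (ι a).η (-(3 : ℝ)) (ι a).Ω (fun x μ => Jcur (ι a).η U₀ A' μ x)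
            + wsup 1 (fun p : {p : ℕ × (Site d × Fin d) // p.1 ≤ (ι a).k ∧ p.2 ∈ towerBondsP L (ι a).Ω ((ι a).Λs (ι a).k) p.1} =>
                linCovIter L U₀ (iEta (ι a).η A') p.1.1 p.1.2.1 p.1.2.2)) + γβ * (α₀ + α₁)) :
    ∃ c : ℝ, 0 < c ∧ ∀ a : J, ∀ α₀ α₁ α₂ : ℝ, 0 < α₀ → α₀ ≤ c → 0 < α₁ → α₁ ≤ c → 0 < α₂ → α₂ ≤ c →
      2 * α₂ ^ 2 + 20 * d * α₀ * α₂ + 2 * (2097152 * ((d : ℝ) + 1) ^ 2 * (L : ℝ) ^ 2) * α₂ ^ 2 ≤ α₀ + α₁ →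
      ∀ (U₀ : (zdGF3HP₂ 𝔸 L β len (ι a)).Cfg) (P' : (zdGF3HP₂ 𝔸 L β len (ι a)).Pert) (f : Site d → 𝔸),
        (zdGF3HP₂ 𝔸 L β len (ι a)).InR U₀ f → (zdGF3HP₂ 𝔸 L β len (ι a)).fNorm f < γ * (α₀ + α₁) → (zdGF3HP₂ 𝔸 L β len (ι a)).fGrad U₀ f < γ * (α₀ + α₁) →
        (zdGF3HP₂ 𝔸 L β len (ι a)).InA α₀ U₀ → (zdGF3HP₂ 𝔸 L β len (ι a)).InAPair α₀ U₀ P' → (zdGF3HP₂ 𝔸 L β len (ι a)).C162 1 α₂ U₀ P' →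
        (zdGF3HP₂ 𝔸 L β len (ι a)).LandauF U₀ f P' → (zdGF3HP₂ 𝔸 L β len (ι a)).C137 α₁ U₀ P' →
        (zdGF3HP₂ 𝔸 L β len (ι a)).C136 (5 * d * L * B₈) (5 * d * L * B₈β) (α₀ + α₁) U₀ P' ∧
          (zdGF3HP₂ 𝔸 L β len (ι a)).C139 (5 * d * L * B₈) (α₀ + α₁) U₀ P' := by
  have hL1 : 1 ≤ L := le_trans (by norm_num) hL
  have hLr : (1 : ℝ) ≤ L := by exact_mod_cast hL1
  have hB₀' : 0 ≤ B₀ := hB₀.le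
  have hL0 : (0 : ℝ) < L := by linarith
  obtain ⟨cN, hcN, hwin⟩ := prop3_windows_γ hd2 hL hB₀'
  refine ⟨min cP (cN / (L : ℝ) ^ 2), lt_min hcP (by positivity), ?_⟩
  intro a α₀ α₁ α₂ hα₀ hα₀c hα₁ _ hα₂ hα₂c h61 U₀ P f hInR hfN hfG hInA hPair h162 hLan h137
  have hα₀P : α₀ ≤ cP := hα₀c.trans (min_le_left _ _)
  have hα₂P : α₂ ≤ cP := hα₂c.trans (min_le_left _ _)
  have hL2 : (0 : ℝ) < (L : ℝ) ^ 2 := by positivity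
  have hα₀N : (L : ℝ) ^ 2 * α₀ ≤ cN := by
    have := hα₀c.trans (min_le_right _ _)
    rw [le_div_iff₀ hL2] at this
    linarith
  have hα₂N : (L : ℝ) * α₂ ≤ cN := by
    have h1 := hα₂c.trans (min_le_right _ _)
    rw [le_div_iff₀ hL2] at h1
    have h2 : (L : ℝ) * α₂ ≤ α₂ * (L : ℝ) ^ 2 := by
      have h3 : (L : ℝ) * α₂ * 1 ≤ (L : ℝ) * α₂ * L := mul_le_mul_of_nonneg_left hLr (by positivity)
      nlinarith [h3]
    linarith
  obtain ⟨hα3, hα4, h16, hd5, hsmall, hc₃, hside, h50, hC⟩ := hwin α₀ α₂ hα₀ hα₀N hα₂.le hα₂N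
  have hC₂' : 8 * (131072 * ((d : ℝ) + 1) ^ 2) * Real.exp (4 * (800 * ((d : ℝ) + 1) ^ 2 * ((d : ℝ) + 4)) * ((L : ℝ) ^ 2 * α₀))
      * (L : ℝ) ^ 2 ≤ 2097152 * ((d : ℝ) + 1) ^ 2 * (L : ℝ) ^ 2 := hC
  have hS0 : 0 ≤ α₀ + α₁ := by linarith
  have hT0 : 0 ≤ γ'' * B₀ * (α₀ + α₁) := by positivity
  -- the data
  set W : Site d → Fin d → 𝔸ˣ := P.2.1 with hW_def
  have hWu : ∀ x κ, W x κ ∈ unitaryUnits 𝔸 := P.2.2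
  have hU₀ : ∀ x κ, U₀.1 x κ ∈ unitaryUnits 𝔸 := U₀.2
  set A : Site d → Fin d → 𝔸 := mlogCfg (ι a).k (ι a).η (ι a).Ω W with hA_def
  -- (1.41) and self-adjointness of the canonical exponent; `W = e^{iηA}` on the `E j`
  have h41 : ∀ j, j ≤ (ι a).k → ∀ (y : Site d) (τ : Fin d), SideTouches ((ι a).Ω j) y τ →
      W y τ = cfgExp (ι a).η A y τ ∧ ‖A y τ‖ ≤ α₂ * ((L : ℝ) ^ j * (ι a).η)⁻¹ := by
    intro j hj y τ hs
    obtain ⟨hexp, -, hbd⟩ := h162 j hj (y, τ) hs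
    have hexp' : W y τ = cfgExp (ι a).η (logCfg (ι a).η W) y τ := hexp
    have hbd' : ‖logCfg (ι a).η W y τ‖ ≤ 1 * α₂ * ((L : ℝ) ^ j * (ι a).η)⁻¹ := hbd
    have hAy : A y τ = logCfg (ι a).η W y τ := mlogCfg_of_sideTouches (ι a).η W hj hs
    refine ⟨?_, ?_⟩
    · rw [hexp']
      exact cfgExp_congr_at (ι a).η hAy.symm
    · rw [hAy]
      simpa only [one_mul] using hbd'
  have hAsa : ∀ y τ, IsSelfAdjoint (A y τ) := by
    intro y τ
    by_cases hmem : ∃ j, j ≤ (ι a).k ∧ SideTouches ((ι a).Ω j) y τ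
    · obtain ⟨j, hj, hs⟩ := hmem
      rw [hA_def, mlogCfg_of_sideTouches (ι a).η W hj hs]
      exact (h162 j hj (y, τ) hs).2.1
    · rw [hA_def, mlogCfg_of_not (ι a).η W fun j hj hs => hmem ⟨j, hj, hs⟩]
      exact IsSelfAdjoint.zero 𝔸
  have hA0 : ∀ (y : Site d) (τ : Fin d), (∀ j, j ≤ (ι a).k → ¬ SideTouches ((ι a).Ω j) y τ) → A y τ = 0 :=
    fun y τ h => mlogCfg_of_not (ι a).η W h
  -- (1.40)₁ for `e^{iηA}U₀` by locality; the Landau clause for `e^{iηA}` by locality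
  have h40₁ : InAk L (ι a).k (ι a).η α₀ (ι a).Ω (mulCfg (expCfg (iEta (ι a).η A)) U₀.1) := by
    refine (inAk_congr_of_sideTouches L (ι a).k (ι a).η α₀ (V := mulCfg W U₀.1) fun j hj y τ hs => ?_).1 hPair
    show W y τ * U₀.1 y τ = expCfg (iEta (ι a).η A) y τ * U₀.1 y τ
    rw [(h41 j hj y τ hs).1, expCfg_iEta_eq_cfgExp]
  -- the global bound and the gradient datum (bounded family)
  have hAglob : ∀ y τ, ‖A y τ‖ ≤ α₂ * (ι a).η⁻¹ := by
    intro y τ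
    by_cases hmem : ∃ j, j ≤ (ι a).k ∧ SideTouches ((ι a).Ω j) y τ
    · obtain ⟨j, hj, hs⟩ := hmem
      have hLj : (1 : ℝ) ≤ (L : ℝ) ^ j := one_le_pow₀ hLr
      have hη0 : 0 < (ι a).η := (ι a).hη
      calc ‖A y τ‖ ≤ α₂ * ((L : ℝ) ^ j * (ι a).η)⁻¹ := (h41 j hj y τ hs).2
        _ = α₂ * (ι a).η⁻¹ * ((L : ℝ) ^ j)⁻¹ := by rw [mul_inv]; ring
        _ ≤ α₂ * (ι a).η⁻¹ * 1 := by
            apply mul_le_mul_of_nonneg_left (inv_le_one_of_one_le₀ hLj) (by positivity)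
        _ = α₂ * (ι a).η⁻¹ := mul_one _
    · rw [hA0 y τ fun j hj hs => hmem ⟨j, hj, hs⟩, norm_zero]
      have hη0 : 0 < (ι a).η := (ι a).hη
      positivity
  have hU₀1 : ∀ x κ, U₀.1 x κ ∈ U1 𝔸 := fun x κ => unitaryUnits_le_U1 (hU₀ x κ)
  have hgrad : ∀ (y : Site d) (κ τ : Fin d), ‖covDerivFwd (ι a).η U₀.1 κ (fun z => A z τ) y‖ ≤ 2 * α₂ * (ι a).η⁻¹ * (ι a).η⁻¹ := by
    intro y κ τ
    have hη0 : 0 < (ι a).η := (ι a).hη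
    unfold covDerivFwd
    rw [norm_smul, norm_inv, Real.norm_eq_abs, abs_of_pos hη0]
    have h1 : ‖B7Eq78Linearization.conjR (U₀.1 y κ) (A (y + e κ) τ) - A y τ‖ ≤ α₂ * (ι a).η⁻¹ + α₂ * (ι a).η⁻¹ := by
      calc ‖B7Eq78Linearization.conjR (U₀.1 y κ) (A (y + e κ) τ) - A y τ‖
          ≤ ‖B7Eq78Linearization.conjR (U₀.1 y κ) (A (y + e κ) τ)‖ + ‖A y τ‖ := norm_sub_le _ _
        _ ≤ α₂ * (ι a).η⁻¹ + α₂ * (ι a).η⁻¹ := by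
            rw [B8Ineq132.norm_conjR (hU₀1 y κ)]
            exact add_le_add (hAglob _ _) (hAglob _ _)
    calc (ι a).η⁻¹ * ‖B7Eq78Linearization.conjR (U₀.1 y κ) (A (y + e κ) τ) - A y τ‖ ≤ (ι a).η⁻¹ * (α₂ * (ι a).η⁻¹ + α₂ * (ι a).η⁻¹) :=
        mul_le_mul_of_nonneg_left h1 (by positivity)
      _ = 2 * α₂ * (ι a).η⁻¹ * (ι a).η⁻¹ := by ring
  have hBg : Bdd L (ι a).k (ι a).η (-(2 : ℝ)) (fun j (t : Fin d × Fin d × Site d) => SideTouches ((ι a).Ω j) t.2.2 t.2.1)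
      (fun t => covDerivFwd (ι a).η U₀.1 t.1 (fun z => A z t.2.1) t.2.2) := by
    have e2 : (-(2 : ℝ)) = -((2 : ℕ) : ℝ) := by norm_num
    rw [e2]
    refine B8ScaledSupNorm.bdd_of_forall (c := 2 * α₂ * ((L : ℝ) ^ (ι a).k) ^ 2) fun j hj t _ => ?_
    rw [B8ScaledSupNorm.weight_neg_natCast L (ι a).η 2 j]
    have hLjk : (L : ℝ) ^ j ≤ (L : ℝ) ^ (ι a).k := pow_le_pow_right₀ hLr hj
    have hLj0 : (0 : ℝ) ≤ (L : ℝ) ^ j := by positivity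
    have hη0 : 0 < (ι a).η := (ι a).hη
    calc ((L : ℝ) ^ j * (ι a).η) ^ 2 * ‖covDerivFwd (ι a).η U₀.1 t.1 (fun z => A z t.2.1) t.2.2‖
        ≤ ((L : ℝ) ^ j * (ι a).η) ^ 2 * (2 * α₂ * (ι a).η⁻¹ * (ι a).η⁻¹) := mul_le_mul_of_nonneg_left (hgrad _ _ _) (by positivity)
      _ = 2 * α₂ * ((L : ℝ) ^ j) ^ 2 := by field_simp
      _ ≤ 2 * α₂ * ((L : ℝ) ^ (ι a).k) ^ 2 := by gcongr
  set g : ℝ := msup L (ι a).k (ι a).η (-(2 : ℝ)) (fun j (t : Fin d × Fin d × Site d) => SideTouches ((ι a).Ω j) t.2.2 t.2.1)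
      (fun t => covDerivFwd (ι a).η U₀.1 t.1 (fun z => A z t.2.1) t.2.2) with hg_def
  have hg0 : 0 ≤ g := B8ScaledSupNorm.msup_nonneg L (ι a).k (ι a).hη.le _ _ _
  have hg : ∀ j, j ≤ (ι a).k → ∀ (y : Site d) (κ τ : Fin d), SideTouches ((ι a).Ω j) y τ →
      ((L : ℝ) ^ j * (ι a).η) ^ 2 * ‖covDerivFwd (ι a).η U₀.1 κ (fun z => A z τ) y‖ ≤ g := by
    intro j hj y κ τ hs
    have h := B8ScaledSupNorm.weight_mul_norm_le_msup hBg hj (i := (κ, τ, y)) hs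
    have hw : weight L (ι a).η (-(2 : ℝ)) j = ((L : ℝ) ^ j * (ι a).η) ^ 2 := by
      have e2 : (-(2 : ℝ)) = -((2 : ℕ) : ℝ) := by norm_num
      rw [e2, B8ScaledSupNorm.weight_neg_natCast L (ι a).η 2 j]
    rw [hw] at h
    exact h
  -- the Landau clause for `e^{iηA}` and the in-edge (1.59), five lines, from the socket
  have hLanA : IsLandau146W L (ι a).k (ι a).η ((ι a).Ω 0) ((ι a).Λs (ι a).k) U₀.1 f W := hLan
  obtain ⟨h59a, h59g, h59j, h59l, h59h⟩ := SB9srcH a α₀ α₁ α₂ hα₀ hα₀P hα₁ hα₂ hα₂P U₀.1 W hU₀ hWu f hInR.1 hInR.2.1 hInR.2.2.1 hInR.2.2.2 hfN hfG hInA hPair hLanA A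
    hAsa h41 hA0
  -- (1.42) = the member's (1.37) clause, on the classified constraint bonds of the top truncation
  have hbox : ∀ j, j ≤ (ι a).k → ∀ c ∈ towerBondsP L (ι a).Ω ((ι a).Λs (ι a).k) j,
      ∀ x, InBox (loK L j c.1) (bondHiK L j c.1 c.2) x → x ∈ (ι a).Ω (j - 1) :=
    fun j _ c hc x hx => towerBondsP_box_subset_pred L (ι a).hΩ ((ι a).Λs (ι a).k) hc x hx
  have h42 : ∀ j, j ≤ (ι a).k → ∀ c ∈ towerBondsP L (ι a).Ω ((ι a).Λs (ι a).k) j,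
      ‖logCovIter L U₀.1 (iEta (ι a).η A) j c.1 c.2‖ < 2 * d * L * α₁ := h137
  have h41' : ∀ j, j ≤ (ι a).k → ∀ (y : Site d) (τ : Fin d), SideTouches ((ι a).Ω j) y τ → ‖A y τ‖ ≤ α₂ * ((L : ℝ) ^ j * (ι a).η)⁻¹ :=
    fun j hj y τ hs => (h41 j hj y τ hs).2
  -- PROPOSITION 3 at `k` levels (n05-b), all four members, and the Hölder member
  obtain ⟨ha, hg', hj, hl⟩ := prop3_norms_kLevel_src4_γ hd2 (ι a).hη hL hU₀ hAsa hα₀ hα₁.le hα₂.le hg0 hα3 hα4 h16 hd5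
    hsmall hc₃ hB₀' hside h50 hC₂' h61 hbox hInA h40₁ h41' hg h42 h59a h59g h59j h59l
  have hh := prop3_fifth_kLevel_src_γ hd2 (ι a).hη hL hU₀ hAsa hα₀ hα₁.le hα₂.le hg0 hα3 hα4 h16 hd5 hsmall hc₃ hB₀' hB₀β
    hside h50 hC₂' h61 hbox hInA h40₁ h41' hg h42 hT0 h59g h59h
  -- the enlarged constants absorb the source terms
  have hc8 : 5 * (d : ℝ) * L * B₀ * (α₀ + α₁) + (γ'' * B₀ * (α₀ + α₁) + γ'' * B₀ * (α₀ + α₁)) ≤ 5 * (d : ℝ) * L * B₈ * (α₀ + α₁) := by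
    have h := mul_le_mul_of_nonneg_right hB8 hS0
    calc 5 * (d : ℝ) * L * B₀ * (α₀ + α₁) + (γ'' * B₀ * (α₀ + α₁) + γ'' * B₀ * (α₀ + α₁))
        = (5 * (d : ℝ) * L * B₀ + 2 * (γ'' * B₀)) * (α₀ + α₁) := by ring
      _ ≤ 5 * (d : ℝ) * L * B₈ * (α₀ + α₁) := h
  have hc8β : 5 * (d : ℝ) * L * B₀β * (α₀ + α₁) + (2 * B₀β * (γ'' * B₀ * (α₀ + α₁)) + γβ * (α₀ + α₁)) ≤
      5 * (d : ℝ) * L * B₈β * (α₀ + α₁) := by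
    have h := mul_le_mul_of_nonneg_right hB8β hS0
    calc 5 * (d : ℝ) * L * B₀β * (α₀ + α₁) + (2 * B₀β * (γ'' * B₀ * (α₀ + α₁)) + γβ * (α₀ + α₁))
        = (5 * (d : ℝ) * L * B₀β + 2 * B₀β * (γ'' * B₀) + γβ) * (α₀ + α₁) := by ring
      _ ≤ 5 * (d : ℝ) * L * B₈β * (α₀ + α₁) := h
  have ha' : msup L (ι a).k (ι a).η (-(1 : ℝ)) (fun j (b : Site d × Fin d) => SideTouches ((ι a).Ω j) b.1 b.2) (fun b => A b.1 b.2) ≤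
      5 * (d : ℝ) * L * B₈ * (α₀ + α₁) := ha.trans hc8
  refine ⟨⟨fun j hj b hb => ?_, hg'.trans (by linarith [hc8]), hh.trans hc8β⟩, hj.trans hc8, hl.trans hc8⟩
  -- (1.36)₁ pointwise on the `E j`, read on the logarithm
  obtain ⟨hexp, hsa, -⟩ := h162 j hj b hb
  refine ⟨hexp, hsa, ?_⟩
  have hpt := B8Thm2GaugeFixedKLevel.thm2_pointwise_A (ι a).hη hL1 h41' ha' hj (y := b.1) (τ := b.2) hb
  rw [← mlogCfg_of_sideTouches (ι a).η W hj hb]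
  exact hpt

end Zd3HP


end Literature.MathematicalPhysics.QuantumFieldTheory.Balaban1983to89.B8Prop3SrcZd3HP2Gamma

end
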